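import Summits.BirchSwinnertonDyer.BirchSwinnertonDyer.Theorems.ClassRecordThreeEulerHalvesAtThreeCartanCorrespondenceCut
import Summits.BirchSwinnertonDyer.BirchSwinnertonDyer.Theorems.ClassRecordThreeEulerHalvesAtThreeCartanTorusCubeCutTori
import HarnessLib

/-!
# Crux 23422 `EulerHalvesAtThreeResidualUpperBound`, line `cartan` v10, stub (F2b♭) — the place `q = 2` of its two finite-group inputs, PROVED:
# the SIGN LATTICE (a Cartan torus lattice of `GL₂(𝔽₂)`), the lattice supply at `2`, and the torus pair sum `S(η) = 3` at `2`

Seat `bsd-stepL-tam3-p1` g22 (LINE OWNER of crux `stmt-BirchSwinnertonDyer-23422`; `--supports stmt-BirchSwinnertonDyer-23422 --as helper`; companion of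
`…CartanStubF2bResidue`, which shows that the registered stub (F2b♭) `CartanDegree.CartanHomLatticeDictionaryAtThreeVal` is, BY NAME and with S-K1′ discharged,
NUM ∧ `CartanCorrespondence.CartanTorusLatticeSupply`, and that the correspondence road needs the supply and U♯ = `CartanCorrespondence.CubicTorusPairSumAtThree`).
Both finite-group inputs quantify over every prime `q ≠ 3`; this file settles their place `q = 2` (where `W_2 = sgn`, `GL₂(𝔽₂) ≅ S₃`), kernel-checked:
* `signTwo`, `signTwo_mul`, `cubicNewvectorChar_two_eq_signTwo` — the sign character of `GL₂(𝔽₂)` on entries and `χ_{W_2} = sgn` (finite checks on entries);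
* `signLattice : CartanTorusLattice 2` — `ℤ¹` with `ρ = sgn`, `B(x, y) = xy`, no non-zero fixed vector mod `3` (a transposition acts by `−1`), `η = (0 1; 1 1)`;
* `cartanTorusLatticeSupply_two` — the `q = 2` instance of `CartanTorusLatticeSupply` VERBATIM (generators `w_s = w_C = 1`: the split torus of `GL₂(𝔽₂)` is
  trivial, the non-split torus `𝔽₂[η]^× = A₃` acts through `sgn = 1`);
* `torusPairSum_two : S(η) = 3` for every elliptic `η ∈ M₂(𝔽₂)` and `cubicTorusPairSum_two` — the `q = 2` instance of `CubicTorusPairSumAtThree` VERBATIM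
  (`S ≠ 0`, `ord₃ S = 1 = 1 + 2·ord₃(2 − 1)`).
HONEST FRAMING: the supply and U♯ at the primes `q ≥ 5` are NOT proved here (an integral model of `W_q` per prime: principal series for `q ≡ 1 (3)`, cuspidal for
`q ≡ 2 (3)` — size L–XL); nothing about (F2b♭), NUM, COR, SIGN; no summit statement, no route item and no registered stub is proved; BSD is proved for no curve.
Searched before filing: `lean search 'CartanTorusLattice 2'` ∕ `'torusPairSum'` ∕ `'signRep'` — only `CartanDegree.cubicTorusPeriodRatio_two` (S-K1′ on an ABSTRACT
lattice at `2`, p678128; its lemmas `gl2_two_eq_one_of_diag`, `gl2_two_centraliser`, `cubicNewvectorChar_two_one` are reused here), no constructed lattice.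
References: [cite: Bump1997, §4.1] [cite: KohenPacetti2016, Rem. 3.8 (arXiv:1403.7801v3 p. 15)].
-/

set_option linter.dupNamespace false -- the layout namespace `Summit.BirchSwinnertonDyer.BirchSwinnertonDyer.…` repeats the summit name (D-0017; as the sibling files)
set_option autoImplicit false

noncomputable section

open scoped MatrixGroups

namespace Summit.BirchSwinnertonDyer.BirchSwinnertonDyer.Theorems.CartanSignLatticeTwo

open Summit.BirchSwinnertonDyer.BirchSwinnertonDyer.Theorems
  Summit.BirchSwinnertonDyer.BirchSwinnertonDyer.Theorems.CartanDegree
  Summit.BirchSwinnertonDyer.BirchSwinnertonDyer.Theorems.CartanTorusCubeCut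
  Summit.BirchSwinnertonDyer.BirchSwinnertonDyer.Theorems.CartanCorrespondence

/-! ## §1 The sign character of `GL₂(𝔽₂)` and `χ_{W_2} = sgn` -/

/-- the sign of an element of `GL₂(𝔽₂) ≅ S₃` written on its entries `(a b; c d)`: `−1` on the three transpositions (trace `a + d = 0` and not the
identity), `+1` on the identity and the two `3`-cycles. [folklore] -/
def signTwoEntries (a b c d : ZMod 2) : ℤ :=
  if a + d = 0 ∧ ¬ (a = 1 ∧ b = 0 ∧ c = 0 ∧ d = 1) then -1 else 1

/-- the sign character of `GL₂(𝔽₂) ≅ S₃`. [folklore] -/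
def signTwo (g : GL (Fin 2) (ZMod 2)) : ℤ :=
  signTwoEntries ((g : Matrix (Fin 2) (Fin 2) (ZMod 2)) 0 0) ((g : Matrix (Fin 2) (Fin 2) (ZMod 2)) 0 1)
    ((g : Matrix (Fin 2) (Fin 2) (ZMod 2)) 1 0) ((g : Matrix (Fin 2) (Fin 2) (ZMod 2)) 1 1)

/-- `signTwoEntries` takes the values `±1`; in particular its square is `1`. [folklore] -/
theorem signTwoEntries_mul_self (a b c d : ZMod 2) : signTwoEntries a b c d * signTwoEntries a b c d = 1 := by
  unfold signTwoEntries; split_ifs <;> norm_num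

/-- `signTwo g · signTwo g = 1`. [folklore] -/
theorem signTwo_mul_self (g : GL (Fin 2) (ZMod 2)) : signTwo g * signTwo g = 1 :=
  signTwoEntries_mul_self _ _ _ _

/-- the determinant of an element of `GL₂(𝔽₂)`, on entries, is non-zero. [folklore] -/
theorem det_entries_ne_zero (g : GL (Fin 2) (ZMod 2)) :
    (g : Matrix (Fin 2) (Fin 2) (ZMod 2)) 0 0 * (g : Matrix (Fin 2) (Fin 2) (ZMod 2)) 1 1 -
      (g : Matrix (Fin 2) (Fin 2) (ZMod 2)) 0 1 * (g : Matrix (Fin 2) (Fin 2) (ZMod 2)) 1 0 ≠ 0 := by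
  have hdet : (g : Matrix (Fin 2) (Fin 2) (ZMod 2)).det ≠ 0 := by
    rw [← Matrix.GeneralLinearGroup.val_det_apply]; exact Units.ne_zero _
  rwa [Matrix.det_fin_two] at hdet

set_option synthInstance.maxSize 8192 in
set_option synthInstance.maxHeartbeats 400000 in
/-- the sign is multiplicative (a finite check on entries: `2⁸` cases). [folklore] -/
theorem signTwo_mul (g h : GL (Fin 2) (ZMod 2)) : signTwo (g * h) = signTwo g * signTwo h := by
  have key : ∀ a b c d e f i j : ZMod 2, a * d - b * c ≠ 0 → e * j - f * i ≠ 0 →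
      signTwoEntries (a * e + b * i) (a * f + b * j) (c * e + d * i) (c * f + d * j) =
        signTwoEntries a b c d * signTwoEntries e f i j := by
    unfold signTwoEntries; decide
  unfold signTwo
  simp only [Matrix.GeneralLinearGroup.coe_mul, Matrix.mul_apply, Fin.sum_univ_two]
  exact key _ _ _ _ _ _ _ _ (det_entries_ne_zero g) (det_entries_ne_zero h)

/-- the sign of the identity is `1`. [folklore] -/
theorem signTwo_one : signTwo 1 = 1 := by
  unfold signTwo signTwoEntries
  simp [Matrix.one_apply_ne]

set_option synthInstance.maxSize 8192 in
set_option synthInstance.maxHeartbeats 400000 in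
/-- **`χ_{W_2} = sgn`**: the cubic-newvector character at `q = 2` is the sign character (finite check on entries: the identity has `χ = 2 − 1 = 1`,
the three transpositions are the non-semisimple non-scalar elements (`χ = −1`), the two `3`-cycles are elliptic with `g¹ ≠ 1` (`χ = 1`)). [folklore] -/
theorem cubicNewvectorChar_two_eq_signTwo (g : GL (Fin 2) (ZMod 2)) : cubicNewvectorChar 2 g = signTwo g := by
  set G : Matrix (Fin 2) (Fin 2) (ZMod 2) := (g : Matrix (Fin 2) (Fin 2) (ZMod 2)) with hG
  have hdet' := det_entries_ne_zero g
  rw [← hG] at hdet'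
  -- the three cases on entries: identity ∕ transposition ∕ 3-cycle
  have key : ∀ a b c d : ZMod 2, a * d - b * c ≠ 0 →
      (a = 1 ∧ b = 0 ∧ c = 0 ∧ d = 1) ∨
      ((a + d) ^ 2 - 4 * (a * d - b * c) = 0 ∧ ¬ (b = 0 ∧ c = 0 ∧ a = d) ∧ (a + d = 0 ∧ ¬ (a = 1 ∧ b = 0 ∧ c = 0 ∧ d = 1))) ∨
      ((a + d) ^ 2 - 4 * (a * d - b * c) ≠ 0 ∧ (¬ ∃ x : ZMod 2, x * x + (a * d - b * c) = (a + d) * x) ∧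
        ¬ (a = 1 ∧ b = 0 ∧ c = 0 ∧ d = 1) ∧ ¬ (a + d = 0 ∧ ¬ (a = 1 ∧ b = 0 ∧ c = 0 ∧ d = 1))) := by
    decide
  have h23 : ¬ (2 % 3 = 1) := by decide
  rcases key (G 0 0) (G 0 1) (G 1 0) (G 1 1) hdet' with ⟨ha, hb, hc, hd⟩ | ⟨hΔ, hsc, hsgn⟩ | ⟨hΔ, hrat, hne, hsgn⟩
  · -- the identity
    have h1 : g = 1 := by
      refine Matrix.GeneralLinearGroup.ext fun i j => ?_
      fin_cases i <;> fin_cases j <;> simp [← hG, ha, hb, hc, hd]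
    rw [h1, cubicNewvectorChar_two_one, signTwo_one]
  · -- a transposition: non-semisimple, not scalar, `χ = −1 = sgn`
    have hΔ' : G.trace ^ 2 - 4 * G.det = 0 := by simpa [Matrix.det_fin_two, Matrix.trace_fin_two] using hΔ
    have hsc' : ¬ IsScalarMat G := by simpa [IsScalarMat] using hsc
    have hs : signTwo g = -1 := by
      unfold signTwo signTwoEntries; rw [← hG]; simp only [hsgn, not_false_eq_true, and_self, if_true]
    rw [hs]
    simp only [cubicNewvectorChar, cubicNewvectorCharMat, ← hG, h23, if_false, hΔ', hsc', if_true]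
  · -- a 3-cycle: elliptic, `g¹ ≠ 1`, `χ = 1 = sgn`
    have hΔ' : G.trace ^ 2 - 4 * G.det ≠ 0 := by simpa [Matrix.det_fin_two, Matrix.trace_fin_two] using hΔ
    have hrat' : ¬ HasRatEigenvalue G := by simpa [HasRatEigenvalue, Matrix.det_fin_two, Matrix.trace_fin_two] using hrat
    have hne' : ¬ G ^ ((2 ^ 2 - 1) / 3) = 1 := by
      intro h1
      norm_num at h1
      apply hne
      have h := fun i j => congrFun (congrFun h1 i) j
      refine ⟨by simpa using h 0 0, by simpa using h 0 1, by simpa using h 1 0, by simpa using h 1 1⟩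
    have hs : signTwo g = 1 := by
      unfold signTwo signTwoEntries; rw [← hG]; simp only [hsgn, if_false]
    rw [hs]
    simp only [cubicNewvectorChar, cubicNewvectorCharMat, ← hG, h23, if_false, hΔ', hrat', hne']

/-! ## §2 The sign lattice -/

/-- the sign representation of `GL₂(𝔽₂)` on `ℤ¹`. [folklore] -/
def signRep : Representation ℤ (GL (Fin 2) (ZMod 2)) (Fin 1 → ℤ) where
  toFun g := signTwo g • LinearMap.id
  map_one' := by rw [signTwo_one, one_smul]; rfl
  map_mul' g h := by
    rw [signTwo_mul]
    apply LinearMap.ext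
    intro v
    simp [mul_smul]

/-- `signRep g v = signTwo g • v`. [folklore] -/
theorem signRep_apply (g : GL (Fin 2) (ZMod 2)) (v : Fin 1 → ℤ) : signRep g v = signTwo g • v := rfl

/-- the product form `B(x, y) = x₀ · y₀` on `ℤ¹`. [folklore] -/
def mulForm : (Fin 1 → ℤ) →ₗ[ℤ] (Fin 1 → ℤ) →ₗ[ℤ] ℤ :=
  (LinearMap.mul ℤ ℤ).compl₁₂ (LinearMap.proj 0) (LinearMap.proj 0)

/-- `mulForm x y = x 0 * y 0`. [folklore] -/
theorem mulForm_apply (x y : Fin 1 → ℤ) : mulForm x y = x 0 * y 0 := rfl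

/-- `η₂ = (0 1; 1 1)`, characteristic polynomial `x² + x + 1`, irreducible over `𝔽₂`. [folklore] -/
def etaTwo : Matrix (Fin 2) (Fin 2) (ZMod 2) := !![0, 1; 1, 1]

/-- `η₂` has no eigenvalue in `𝔽₂`. [folklore] -/
theorem etaTwo_irred : ¬ HasRatEigenvalue etaTwo := by
  rintro ⟨x, hx⟩
  simp only [etaTwo, Matrix.det_fin_two_of, Matrix.trace_fin_two_of] at hx
  revert x; decide

/-- the transposition `(0 1; 1 0) ∈ GL₂(𝔽₂)`. [folklore] -/
def swapTwo : GL (Fin 2) (ZMod 2) :=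
  Matrix.GeneralLinearGroup.mkOfDetNeZero !![0, 1; 1, 0] (by simp [Matrix.det_fin_two_of])

/-- the transposition has sign `−1`. [folklore] -/
theorem signTwo_swapTwo : signTwo swapTwo = -1 := by
  unfold signTwo signTwoEntries swapTwo
  simp [Matrix.GeneralLinearGroup.mkOfDetNeZero]

/-- **THE SIGN LATTICE — a Cartan torus lattice at `q = 2`**: `ℤ¹` with `GL₂(𝔽₂) ≅ S₃` acting through `sgn = χ_{W_2}`, `B(x,y) = xy` (invariant, positive
definite), no non-zero fixed vector mod `3` (a transposition acts by `−1`, and `−v ≡ v (3)` forces `3 ∣ v`), `η = (0 1; 1 1)`. [folklore] -/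
def signLattice : CartanTorusLattice 2 where
  d := 1
  ρ := signRep
  trace_eq g := by
    show LinearMap.trace ℤ (Fin 1 → ℤ) (signTwo g • LinearMap.id) = cubicNewvectorChar 2 g
    rw [map_smul, LinearMap.trace_id, Module.finrank_fin_fun, cubicNewvectorChar_two_eq_signTwo]
    simp
  B := mulForm
  B_symm x y := by rw [mulForm_apply, mulForm_apply, mul_comm]
  B_pos x hx := by
    rw [mulForm_apply]
    have h0 : x 0 ≠ 0 := by
      intro h; apply hx; funext i; fin_cases i; exact h
    exact mul_self_pos.mpr h0
  B_inv g x y := by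
    rw [mulForm_apply, mulForm_apply, signRep_apply, signRep_apply, Pi.smul_apply, Pi.smul_apply, smul_eq_mul, smul_eq_mul]
    calc signTwo g * x 0 * (signTwo g * y 0) = (signTwo g * signTwo g) * (x 0 * y 0) := by ring
      _ = x 0 * y 0 := by rw [signTwo_mul_self, one_mul]
  noFixedVectorModThree v hv := by
    obtain ⟨w, hw⟩ := hv swapTwo
    rw [signRep_apply, signTwo_swapTwo] at hw
    refine ⟨v + w, ?_⟩
    have h0 := congrFun hw 0
    simp only [Pi.sub_apply, Pi.smul_apply, smul_eq_mul] at h0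
    funext i; fin_cases i
    simp only [Fin.zero_eta, Pi.smul_apply, Pi.add_apply, smul_eq_mul]
    omega
  η := etaTwo
  η_irred := etaTwo_irred

/-- every vector of the sign lattice is fixed by the (trivial) split torus of `GL₂(𝔽₂)`. [folklore] -/
theorem signLattice_isSplitFixed (v : Fin 1 → ℤ) : signLattice.IsSplitFixed v := by
  intro g h01 h10
  show signRep g v = v
  rw [gl2_two_eq_one_of_diag g h01 h10, map_one]
  rfl

/-- every vector of the sign lattice is fixed by the non-split torus `𝔽₂[η]^× ≅ A₃` (on which `sgn = 1`). [folklore] -/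
theorem signLattice_isNonsplitFixed (v : Fin 1 → ℤ) : signLattice.IsNonsplitFixed v := by
  intro g hg
  show signRep g v = v
  rcases gl2_two_centraliser etaTwo etaTwo_irred g hg with h1 | hχ
  · rw [h1, map_one]; rfl
  · rw [signRep_apply, ← cubicNewvectorChar_two_eq_signTwo, hχ, one_smul]

/-- every vector of `ℤ¹` is an integer multiple of `1`. [folklore] -/
theorem eq_smul_one_of_fin_one (v : Fin 1 → ℤ) : ∃ m : ℤ, v = m • (fun _ => (1 : ℤ)) :=
  ⟨v 0, by funext i; fin_cases i; simp⟩

/-- **THE LATTICE SUPPLY AT `q = 2` (PROVED)** — the `q = 2` instance of `CartanCorrespondence.CartanTorusLatticeSupply`: the sign lattice with generators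
`w_s = w_C = 1` of its two (rank-one, equal) torus-fixed lines. [folklore] -/
theorem cartanTorusLatticeSupply_two :
    ∃ (𝓛 : CartanTorusLattice 2) (wS wC : Fin 𝓛.d → ℤ),
      𝓛.IsSplitFixed wS ∧ 𝓛.IsNonsplitFixed wC ∧
      (∀ v, 𝓛.IsSplitFixed v → ∃ m : ℤ, v = m • wS) ∧ (∀ v, 𝓛.IsNonsplitFixed v → ∃ m : ℤ, v = m • wC) ∧ wS ≠ 0 ∧ wC ≠ 0 := by
  refine ⟨signLattice, fun _ => 1, fun _ => 1, signLattice_isSplitFixed _, signLattice_isNonsplitFixed _,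
    fun v _ => eq_smul_one_of_fin_one v, fun v _ => eq_smul_one_of_fin_one v, ?_, ?_⟩ <;>
  · intro h; have := congrFun h ⟨0, Nat.one_pos⟩; simp at this

/-! ## §3 The torus pair sum at `2` -/

/-- at `q = 2` the split torus of `GL₂(𝔽₂)` is `{1}`. [folklore] -/
theorem splitTorus_two : splitTorus 2 = {1} := by
  ext g
  simp only [splitTorus, Finset.mem_filter, Finset.mem_univ, true_and, Finset.mem_singleton]
  constructor
  · rintro ⟨h01, h10⟩; exact gl2_two_eq_one_of_diag g h01 h10
  · rintro rfl; simp

/-- **THE TORUS PAIR SUM AT `q = 2` (PROVED)**: for every elliptic `η ∈ M₂(𝔽₂)`, `S(η) = Σ_{s ∈ T_s} Σ_{t ∈ 𝔽₂[η]^×} χ_{W_2}(st) = 3`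
(`T_s = 1`, `𝔽₂[η]^× = A₃` has three elements, each with `χ = sgn = 1`). [folklore] -/
theorem torusPairSum_two (η : Mat 2) (hη : ¬ HasRatEigenvalue η) : torusPairSum 2 η = 3 := by
  unfold torusPairSum
  rw [splitTorus_two, Finset.sum_singleton]
  have h1 : ∀ t ∈ nonsplitTorus η, cubicNewvectorChar 2 (1 * t) = 1 := by
    intro t ht
    rw [one_mul]
    simp only [nonsplitTorus, Finset.mem_filter, Finset.mem_univ, true_and] at ht
    rcases gl2_two_centraliser η hη t ht with h | h
    · rw [h]; exact cubicNewvectorChar_two_one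
    · exact h
  rw [Finset.sum_congr rfl h1, Finset.sum_const, nonsplitTorus_card hη]
  simp

/-- **U♯ AT `q = 2` (PROVED)** — the `q = 2` instance of `CartanCorrespondence.CubicTorusPairSumAtThree` ∕ `…CuspidalPlaces`: `η = (0 1; 1 1)` is elliptic,
`S(η) = 3 ≠ 0` and `ord₃ S(η) = 1 = 1 + 2·ord₃(2 − 1)`. [folklore] -/
theorem cubicTorusPairSum_two :
    ∃ η : Mat 2, ¬ HasRatEigenvalue η ∧ torusPairSum 2 η ≠ 0 ∧ padicValInt 3 (torusPairSum 2 η) = 1 + 2 * padicValNat 3 (2 - 1) := by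
  refine ⟨etaTwo, etaTwo_irred, ?_, ?_⟩
  · rw [torusPairSum_two etaTwo etaTwo_irred]; norm_num
  · haveI : Fact (Nat.Prime 3) := ⟨Nat.prime_three⟩
    rw [torusPairSum_two etaTwo etaTwo_irred, show (3 : ℤ) = ((3 : ℕ) : ℤ) by norm_num, padicValInt.of_nat, padicValNat_self]
    simp

end Summit.BirchSwinnertonDyer.BirchSwinnertonDyer.Theorems.CartanSignLatticeTwo

end
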